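import Summits.HubbardSuperconductivity.HubbardSuperconductivity.Theorems.BalabanIRBirComplexStableXYRCovarianceFRDGradient
import Literature.Probability.Distributions.GaussianVectorMaxTail
import HarnessLib

/-!
# Crux `BirComplexStableXYR` (stmt-HubbardSuperconductivity-14845): M2a — small-field probabilities
# of the scale-`N` fluctuation field of the reference covariance, volume-uniformly

Support file (prover seat 1, route BalabanIR), on top of `…CovarianceFRDGradient.lean` (the smooth
finite-range pieces `C^{(m)}_N` of the Hessian `H` of `Q_c` with volume-uniform gradient bounds) and
the tree's Gaussian maximal inequality `Literature/Probability/Distributions/GaussianVectorMaxTail.lean`.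
In a multiscale expansion of the engine's measure around its Gaussian backbone the scale-`N`
fluctuation field is the centred Gaussian vector `ζ_N ~ N(0, t·C^{(m)}_N)` on the space-time torus
(`t = 4/(KΛ_c)` for the engine; any `t > 0` here), and the large-field regions of scale `N` are
where an increment `ζ_N(x+E_i) − ζ_N(x)` exceeds a threshold `s`.  This file PROVES the volume-uniform
smallness of that event:

* `cfrd_increment_variance_le` — the variance of an increment is a mixed second difference of the
  covariance: `Var(ζ_N(x+E_i) − ζ_N(x)) = t·(∇_{E_i}∇_{−E_i}C^{(m)}_N)(x,x) ≤ t·K(m,2,4c₀/Λ_c)·2^{−3N}`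
  (`m ≥ 2`; the `k = 2` case of the gradient bound) — the `d_eff = 3` scaling `[∇ζ_N] ~ 2^{−3N/2}`;
* **`birHessian_fluctuation_smallField`** (registered stub of this seat on the crux item): for every
  finite set of sites `X`, threshold `s ≥ 0`, `m ≥ 2`, `2^N ≤ L, M`, `t > 0`:
  `P(∃ x ∈ X, ∃ i, |ζ_N(x+E_i) − ζ_N(x)| ≥ s) ≤ 6|X|·exp(−s²·2^{3N}/(2tK))`,
  `K = K(m,2,4c₀/Λ_c) = (27m(2π)²/4)(1 + 2⁶π^{2m+2}/(16·4c₀/Λ_c)^{m+1})` — UNIFORM IN THE VOLUME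
  (Bauerschmidt–Brydges–Slade 2019 §10.1 "fluctuation-field regularity"; Balaban/Dimock small-field
  conditions), for the engine's general coercive finite-range form and every admissible table.

No definitions; sorry-free. [folklore]
-/

noncomputable section

namespace Summit.HubbardSuperconductivity.HubbardSuperconductivity.Theorems

set_option linter.dupNamespace false -- summit = problem name (single-conjunct summit), D-0017

open scoped BigOperators Matrix ComplexConjugate NNReal
open Complex Summit.HubbardSuperconductivity.BirComplexStableXYNegative MeasureTheory ProbabilityTheory
open Literature.Probability.LatticeModels Literature.Analysis.Matrix Literature.Analysis.Fourier
open Literature.Probability.Distributions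

section FluctuationSmallField

variable {r : ℕ} {L M : ℕ} [NeZero L] [NeZero M]

-- The window linear form `a_{(s,n)}(j) = Σ_w n_w [sh s w = j]` (local abbreviation).
set_option quotPrecheck false in
local notation "aform[" L' "," M' "](" s "," n "," j ")" =>
  ∑ w, (((n w : ℤ) : ℝ) * (if sh L' M' s w = j then (1 : ℝ) else 0))

-- The inline Hessian matrix of `Q_c` (local abbreviation).
set_option quotPrecheck false in
local notation "Hm[" c' "," L' "," M' "]" => (Matrix.of fun i j : Λ L' M' =>
  (-(∑ k : Λ L' M' × ↥((c' : Table _).support),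
    (c' : Table _) k.2 * ((aform[L',M'](k.1, k.2.1, i) : ℝ) : ℂ)
      * ((aform[L',M'](k.1, k.2.1, j) : ℝ) : ℂ))).re)

-- the three unit steps of the space-time torus (local abbreviation; inline in statements)
set_option quotPrecheck false in
local notation "Evec[" L' "," M' "]" =>
  (![((![1, 0] : Literature.Probability.LatticeModels.TorusSite 2 L'), (0 : ZMod M')), (![0, 1], 0), (0, 1)]
    : Fin 3 → Λ L' M')

/-! ## Increments as linear functionals -/

/-- The increment functional: with `ℓ = δ_a − δ_b`, `Σ_y ℓ_y z_y = z_a − z_b`. [folklore] -/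
theorem cfrd_increment_dotProduct (a b : Λ L M) (z : EuclideanSpace ℝ (Λ L M)) :
    ∑ y, ((if y = a then (1 : ℝ) else 0) - (if y = b then (1 : ℝ) else 0)) * z y = z a - z b := by
  simp only [sub_mul, Finset.sum_sub_distrib, ite_mul, one_mul, zero_mul, Finset.sum_ite_eq',
    Finset.mem_univ, if_true]

/-- The quadratic form of an increment is a mixed second difference of the kernel:
`(δ_{x+g} − δ_x)ᵀ S (δ_{x+g} − δ_x) = S(x+g,x+g) − S(x,x+g) − S(x+g,x) + S(x,x)`. [folklore] -/
theorem cfrd_increment_form (S : Matrix (Λ L M) (Λ L M) ℝ) (x g : Λ L M) :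
    (fun y => (if y = x + g then (1 : ℝ) else 0) - (if y = x then (1 : ℝ) else 0)) ⬝ᵥ
        S *ᵥ (fun y => (if y = x + g then (1 : ℝ) else 0) - (if y = x then (1 : ℝ) else 0))
      = S (x + g) (x + g) - S x (x + g) - S (x + g) x + S x x := by
  have hvec : (fun y => (if y = x + g then (1 : ℝ) else 0) - (if y = x then (1 : ℝ) else 0))
      = Pi.single (x + g) (1 : ℝ) - Pi.single x (1 : ℝ) := by
    funext y; simp [Pi.single_apply, eq_comm]
  rw [hvec, sub_dotProduct, Matrix.mulVec_sub, dotProduct_sub, dotProduct_sub]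
  simp only [Matrix.mulVec_single_one, single_one_dotProduct, Matrix.col_apply]
  ring

/-- **Variance of an increment of the scale-`N` fluctuation field**: for the smooth piece
`C = C^{(m)}_N` of the rescaled Hessian (`m ≥ 2`, `2^N ≤ L, M`) and `t ≥ 0`,
`(δ_{x+E_i} − δ_x)ᵀ (t•C) (δ_{x+E_i} − δ_x) ≤ t·K(m,2,4c₀/Λ_c)·2^{−3N}`. [folklore] -/
theorem cfrd_increment_variance_le (hr : 2 ≤ r) (c : Table r) {c₀ : ℝ} (hc₀ : 0 < c₀)
    (hN : c.sum (fun _ a => a) = 0)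
    (hC : ∀ φ : W r → ℝ, c₀ * ∑ w, ∑ w', (1 - Real.cos (φ w - φ w')) ≤ (genF c φ).re)
    {m : ℕ} (hm : 2 ≤ m) (N : ℕ) (hL : 2 ^ N ≤ L) (hM : 2 ^ N ≤ M) {t : ℝ} (ht : 0 ≤ t)
    (x : Λ L M) (i : Fin 3) :
    (fun y => (if y = x + Evec[L,M] i then (1 : ℝ) else 0) - (if y = x then (1 : ℝ) else 0)) ⬝ᵥ
        (t • frdPiecePow ((4 / (2 * normA c * (r : ℝ) ^ 3)) • Hm[c,L,M]) m N) *ᵥ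
          (fun y => (if y = x + Evec[L,M] i then (1 : ℝ) else 0) - (if y = x then (1 : ℝ) else 0))
      ≤ t * (27 * m * (2 * Real.pi) ^ 2 / 4
          * (1 + 2 ^ 6 * Real.pi ^ (2 * m + 2) / (16 * (4 * c₀ / (2 * normA c * (r : ℝ) ^ 3))) ^ (m + 1)))
          / ((2 : ℝ) ^ N) ^ 3 := by
  set C := frdPiecePow ((4 / (2 * normA c * (r : ℝ) ^ 3)) • Hm[c,L,M]) m N with hCdef
  have hti : IsTranslationInvariant C := isTranslationInvariant_frdPiecePow ((cfrd_translationInvariant c).smul _) m N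
  rw [Matrix.smul_mulVec, dotProduct_smul, smul_eq_mul, cfrd_increment_form, mul_div_assoc]
  refine mul_le_mul_of_nonneg_left ?_ ht
  -- the mixed difference at `y = x` with `g = h = E_i`
  have hl : ∀ g ∈ [Evec[L,M] i, -(Evec[L,M] i)], ∃ i' : Fin 3, g = Evec[L,M] i' ∨ g = -(Evec[L,M] i') := by
    intro g hg
    simp only [List.mem_cons, List.not_mem_nil, or_false] at hg
    rcases hg with rfl | rfl
    · exact ⟨i, Or.inl rfl⟩
    · exact ⟨i, Or.inr rfl⟩
  have h := cfrd_frdPiecePow_gradient hr c hc₀ hN hC m N hL hM [Evec[L,M] i, -(Evec[L,M] i)] hl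
    (by simp; omega) x x
  rw [← hti.mixedDiff_eq_rowDiffs] at h
  refine (le_abs_self _).trans (h.trans (le_of_eq ?_))
  norm_num [List.length_cons, List.length_nil]

/-! ## The small-field probability (registered stub) -/

/-- The rescaled Hessian's smooth pieces, scaled by `t ≥ 0`, are positive semidefinite (a covariance).
[folklore] -/
theorem cfrd_smul_frdPiecePow_posSemidef (hr : 2 ≤ r) (c : Table r) {c₀ : ℝ} (hc₀ : 0 < c₀)
    (hN : c.sum (fun _ a => a) = 0)
    (hC : ∀ φ : W r → ℝ, c₀ * ∑ w, ∑ w', (1 - Real.cos (φ w - φ w')) ≤ (genF c φ).re)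
    (m N : ℕ) {t : ℝ} (ht : 0 ≤ t) :
    (t • frdPiecePow ((4 / (2 * normA c * (r : ℝ) ^ 3)) • Hm[c,L,M]) m N).PosSemidef := by
  obtain ⟨hAherm, -, -, hA4, -⟩ := cfrd_scaled_facts (L := L) (M := M) hr c hc₀ hN hC
  exact (posSemidef_frdPiecePow hAherm hA4 m N).smul ht

/-- **M2a — small-field probability of the scale-`N` fluctuation increments, volume-uniformly
(registered stub `birHessian_fluctuation_smallField` of prover seat 1 on crux 2R).**
`P(∃ x ∈ X, ∃ i, |ζ_N(x+E_i) − ζ_N(x)| ≥ s) ≤ 6|X| exp(−s²2^{3N}/(2tK))` for `ζ_N ~ N(0, t·C^{(m)}_N)`,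
`m ≥ 2`, `2^N ≤ L, M`, `t > 0`, `s ≥ 0`. [folklore] -/
theorem birHessian_fluctuation_smallField : ∀ (r : ℕ) (c : Table r) (c₀ : ℝ), 2 ≤ r → 0 < c₀ → c.sum (fun _ a => a) = 0 → (∀ φ : W r → ℝ, c₀ * ∑ w, ∑ w', (1 - Real.cos (φ w - φ w')) ≤ (genF c φ).re) → ∀ (L M : ℕ) [NeZero L] [NeZero M] (m N : ℕ), 2 ≤ m → 2 ^ N ≤ L → 2 ^ N ≤ M → ∀ (t : ℝ), 0 < t → ∀ (X : Finset (Λ L M)) (s : ℝ), 0 ≤ s → (ProbabilityTheory.multivariateGaussian 0 (t • Literature.Analysis.Matrix.frdPiecePow ((4 / (2 * normA c * (r : ℝ) ^ 3)) • (Matrix.of fun i j : Λ L M => (-(∑ k : Λ L M × ↥c.support, c k.2 * ((∑ w, ((k.2 : Freq r) w : ℝ) * (if sh L M k.1 w = i then (1 : ℝ) else 0) : ℝ) : ℂ) * ((∑ w, ((k.2 : Freq r) w : ℝ) * (if sh L M k.1 w = j then (1 : ℝ) else 0) : ℝ) : ℂ))).re)) m N)).real {z : EuclideanSpace ℝ (Λ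 L M) | ∃ x ∈ X, ∃ i : Fin 3, s ≤ |z (x + (![((![1, 0] : Literature.Probability.LatticeModels.TorusSite 2 L), (0 : ZMod M)), (![0, 1], 0), (0, 1)] : Fin 3 → Λ L M) i) - z x|} ≤ 6 * X.card * Real.exp (-s ^ 2 / (2 * (t * (27 * m * (2 * Real.pi) ^ 2 / 4 * (1 + 2 ^ 6 * Real.pi ^ (2 * m + 2) / (16 * (4 * c₀ / (2 * normA c * (r : ℝ) ^ 3))) ^ (m + 1))) / ((2 : ℝ) ^ N) ^ 3))) := by
  intro r c c₀ hr hc₀ hN hC L M _ _ m N hm hL hM t ht X s hs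
  set S := t • frdPiecePow ((4 / (2 * normA c * (r : ℝ) ^ 3)) • Hm[c,L,M]) m N with hSdef
  set K : ℝ := 27 * m * (2 * Real.pi) ^ 2 / 4
      * (1 + 2 ^ 6 * Real.pi ^ (2 * m + 2) / (16 * (4 * c₀ / (2 * normA c * (r : ℝ) ^ 3))) ^ (m + 1))
    with hKdef
  have hscale := cfrd_scale_pos hr c hc₀ hC
  have hK0 : 0 ≤ K := by rw [hKdef]; positivity
  have hS : S.PosSemidef := cfrd_smul_frdPiecePow_posSemidef hr c hc₀ hN hC m N ht.le
  -- the family of increment functionals indexed by `X × Fin 3`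
  set ℓ : Λ L M × Fin 3 → Λ L M → ℝ := fun p y =>
    (if y = p.1 + Evec[L,M] p.2 then (1 : ℝ) else 0) - (if y = p.1 then (1 : ℝ) else 0) with hℓ
  have hvnn : 0 ≤ t * K / ((2 : ℝ) ^ N) ^ 3 := by positivity
  set v : ℝ≥0 := (t * K / ((2 : ℝ) ^ N) ^ 3).toNNReal with hvdef
  have hvcoe : (v : ℝ) = t * K / ((2 : ℝ) ^ N) ^ 3 := by rw [hvdef]; exact Real.coe_toNNReal _ hvnn
  have hv : ∀ p ∈ X ×ˢ (Finset.univ : Finset (Fin 3)), ℓ p ⬝ᵥ S *ᵥ ℓ p ≤ v := by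
    intro p _
    rw [hvcoe]
    exact cfrd_increment_variance_le hr c hc₀ hN hC hm N hL hM ht.le p.1 p.2
  have hmain := measureReal_exists_abs_dotProduct_ge_le hS (X ×ˢ (Finset.univ : Finset (Fin 3))) ℓ hv hs
  -- identify the events
  have hℓsum : ∀ (p : Λ L M × Fin 3) (z : EuclideanSpace ℝ (Λ L M)),
      ∑ y, ℓ p y * z y = z (p.1 + Evec[L,M] p.2) - z p.1 := fun p z => by
    rw [hℓ]; exact cfrd_increment_dotProduct _ _ z
  have hset : {z : EuclideanSpace ℝ (Λ L M) | ∃ x ∈ X, ∃ i : Fin 3, s ≤ |z (x + Evec[L,M] i) - z x|}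
      = {z : EuclideanSpace ℝ (Λ L M) | ∃ p ∈ X ×ˢ (Finset.univ : Finset (Fin 3)), s ≤ |∑ y, ℓ p y * z y|} := by
    ext z
    simp only [Set.mem_setOf_eq, hℓsum]
    constructor
    · rintro ⟨x, hx, i, h⟩
      exact ⟨(x, i), Finset.mem_product.mpr ⟨hx, Finset.mem_univ _⟩, h⟩
    · rintro ⟨p, hp, h⟩
      exact ⟨p.1, (Finset.mem_product.mp hp).1, p.2, h⟩
  rw [hset]
  refine hmain.trans (le_of_eq ?_)
  rw [Finset.card_product, Finset.card_univ, Fintype.card_fin, Nat.cast_mul, hvcoe]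
  push_cast
  ring

end FluctuationSmallField

end Summit.HubbardSuperconductivity.HubbardSuperconductivity.Theorems

end
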